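import Summits.BirchSwinnertonDyer.BirchSwinnertonDyer.Theorems.GenusKolyvaginAtTwoMinimalTwinBSDTwoRouteLedgerLine25Supplies
import Summits.BirchSwinnertonDyer.BirchSwinnertonDyer.Theorems.GenusKolyvaginAtTwoMinimalTwinBSDTwoEggSplit
import HarnessLib

/-!
# Route `GenusKolyvaginAtTwo`, crux U₂ `MinimalTwinBSDTwo` (stmt-BirchSwinnertonDyer-22985): ON THE EGG THE REVERSED SUPPLY NEEDS NO
# SELMER CLAUSE — `hTw0^{egg,S₃} ⟸ S1⁺ + S2″₀ + PRINT` with S2″₀ := LINE 23's S2″ on the egg locus WITHOUT `#Sel₂(Wd) = 1`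

Seat `bsd-line-gk2-p3` g28 (PROVER seat 3/3, cell `bsd-f1-sign2`), `--supports stmt-BirchSwinnertonDyer-22985` (helper; closes nothing).
THEOREMS ONLY (no definition, no named fact, no `sorry`); standard axioms.  **BSD is NOT proved by this file; nothing is closed.**  CONDITIONAL
on the displayed hypotheses (the sliced wall S1⁺, the supply S2″₀ — beyond print as stated — and the four STATEMENT-ONLY print facts).

THE POINT.  LINE 23 v1.5 (gk2-p2 g24) restricts its `Δ > 0` supply to the egg and KEEPS the clause `#Sel₂(Wd) = 1`.  By this seat's
`Egg.natCard_selmerGroup_twin_eq_one_of_meetsEgg_of_silent` (p769884, UNCONDITIONAL: Kramer Prop. 6 / Mazur–Rubin Cor. 3.4 (i) at `T = {∞}`)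
that clause is AUTOMATIC on the egg for every silent odd Heegner twin of an S₃-curve of rank `1` with `#Sel₂ = 2`.  So the `Δ > 0` supply may be
asked in the weaker form S2″₀ — «for `W` non-CM, `r_an = 1`, `#Sel₂ = 2`, `C(W)` odd, `ρ̄_{W,2}` onto, `0 < Δ`, MEETING THE EGG: a Heegner
field `K` (`d_K` odd `≠ −3`), a datum (`c ≠ 0`), `P(1)` of infinite order with `2^(ord₂ c) ∥ P(1)`, and a globally minimal ALL-SILENT twin
(`ord₂ C(Wd) = 0`)» — NO Selmer clause: what is left beyond print is the Heegner non-vanishing (`P(1)` of infinite order, i.e.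
`L(W^{(d_K)},1) ≠ 0` for a silent Heegner field) and the lossless exponent clause.

* **`hTw0eggS_of_slicedWall_of_reversedSilentSupplyEgg_of_facts`** — `hTw0^{egg,S₃} ⟸ S1⁺ + S2″₀ + PRINT` (engine g23's
  `swappedPairDescentAtTwo_maninExponent_of_facts`, p766443; the Selmer clause produced inside by the Egg Split; rank `1` from GZK).

References: [Kramer1981] §2 Props. 3, 6; [MazurRubin2010] Cor. 3.4 (i); [GrossZagier1986] V.§2 (2.2); [Milne1972ArithmeticAV] §1 Thm. 1;
[Miller2011LMS] Def. 1.1.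
-/

set_option autoImplicit false
set_option linter.dupNamespace false -- `Summit.<P>.<Sub>` repeats `BirchSwinnertonDyer` (D-0017)

noncomputable section

open scoped Classical

open WeierstrassCurve NumberField Literature.NumberTheory.EllipticCurves
  Literature.NumberTheory.EllipticCurves.ModularForms
  Literature.NumberTheory.EllipticCurves.Rank1Residual
  Literature.NumberTheory.EllipticCurves.Rank1Residual.Typed
  Literature.NumberTheory.EllipticCurves.KrizLi2019
  Summit.BirchSwinnertonDyer.Rank1Residual
  Summit.BirchSwinnertonDyer.Rank1Residual.AdditivePotMult
  Summit.BirchSwinnertonDyer.Rank1Residual.F1Sign2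
  Summit.BirchSwinnertonDyer.BirchSwinnertonDyer.Rank1Residual
  Summit.BirchSwinnertonDyer.BirchSwinnertonDyer.Theses.GenusKolyvaginAtTwo
  Summit.BirchSwinnertonDyer.BirchSwinnertonDyer.Theorems.CMExactDescent
  Summit.BirchSwinnertonDyer.BirchSwinnertonDyer.Theorems.GenusExact.TwinSwap
  Summit.BirchSwinnertonDyer.BirchSwinnertonDyer.Theorems.GenusExact.TwinSwap.OneBit
  Summit.BirchSwinnertonDyer.BirchSwinnertonDyer.Theorems.GenusExact.PlusDescent

namespace Summit.BirchSwinnertonDyer.BirchSwinnertonDyer.Theorems.GenusExact.TwinSwap.Ledger.Line25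

/-- **`hTw0^{egg,S₃} ⟸ S1⁺ + S2″₀ + PRINT` — the reversed all-silent supply WITHOUT its Selmer clause.**  `hS1pos` = the wall on
(`r_an = 0`, `#Sel₂ = 1`, `Δ > 0`, `ord₂ C = 0`); `hS2egg0` = S2″₀ as in the header (S2″'s text with premises `ρ̄_{W,2}` onto, `0 < Δ`,
`MeetsEgg W` added and the clause `#Sel₂(Wd) = 1` REMOVED, budget clause `ord₂ C(Wd) = 0`); PRINT = GZ, GZK, modularity, Milne.  Conclusion:
`BSD₂` on `hTw0^{egg,S₃}`.  Inside: `#Sel₂(Wd) = 1` by `Egg.natCard_selmerGroup_twin_eq_one_of_meetsEgg_of_silent` (rank `1` from GZK, silence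
from `ord₂ C(Wd) = 0 = ord₂ C(W)`), then p768862 §1 verbatim.  CONDITIONAL on the displayed hypotheses; BSD is NOT proved; nothing is closed.
[cite: Kramer1981, §2 Prop. 6] [cite: MazurRubin2010, Cor. 3.4 (i)] [cite: GrossZagier1986, V.§2 (2.2)] [cite: Miller2011LMS, Def. 1.1] -/
theorem hTw0eggS_of_slicedWall_of_reversedSilentSupplyEgg_of_facts
    (hGZ : ∀ (N : ℕ) [NeZero N] (W : WeierstrassCurve ℚ) (K : Type) [Field K] [NumberField K], gross_zagier N W K)
    (hGZK : rank_eq_analyticRank_of_analyticRank_le_one) (hmod : hasEntireLFunction_rat)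
    (hMilneC : Milne1972.bsdQuotient_baseChange_quadratic_anyModel)
    (hS1pos : ∀ (W : WeierstrassCurve ℚ) [W.IsElliptic] [W.IsGloballyMinimal],
      ¬ W.HasCM → W.analyticRank = 0 → Nat.card (W.selmerGroup 2) = 1 → 0 < W.Δ → padicValNat 2 W.tamagawaProduct = 0 → BSDp W 2)
    (hS2egg0 : ∀ (W : WeierstrassCurve ℚ) [W.IsElliptic] [W.IsGloballyMinimal] [NeZero (W.conductorNorm ℤ)],
      ¬ W.HasCM → W.analyticRank = 1 → Nat.card (W.selmerGroup 2) = 2 → Odd W.tamagawaProduct → W.HasSurjectiveModNGaloisRep 2 →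
      0 < W.Δ → MeetsEgg W →
      ∃ (K : Type) (_ : Field K) (_ : NumberField K),
        IsImaginaryQuadratic K ∧ Odd (NumberField.discr K) ∧ NumberField.discr K ≠ -3 ∧ SatisfiesHeegnerHypothesis (W.conductorNorm ℤ) K ∧
        ∃ (Dt : ModularParametrizationData W (W.conductorNorm ℤ)) (β : ℤ) (ι : K →+* ℂ) (d₁ : KolyvaginHeegnerData Dt β ι 1),
          Dt.c ≠ 0 ∧ ¬ IsOfFinAddOrder d₁.derivedPoint ∧
          (∃ M₀ : ℕ, padicValInt 2 Dt.c = M₀ ∧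
            (∃ Q : (W.baseChange (ringClassField K ι 1)).toAffine.Point, ((2 ^ M₀ : ℕ) : ℤ) • Q = d₁.derivedPoint) ∧
            (¬ ∃ Q : (W.baseChange (ringClassField K ι 1)).toAffine.Point, ((2 ^ (M₀ + 1) : ℕ) : ℤ) • Q = d₁.derivedPoint)) ∧
          ∃ (Wd : WeierstrassCurve ℚ) (_ : Wd.IsElliptic) (_ : Wd.IsGloballyMinimal),
            (∃ C : VariableChange ℚ, C • W.quadraticTwist (NumberField.discr K : ℚ) = Wd) ∧ padicValNat 2 Wd.tamagawaProduct = 0) :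
    ∀ (W : WeierstrassCurve ℚ) [W.IsElliptic] [W.IsGloballyMinimal], ¬ W.HasCM → W.analyticRank = 1 →
      Nat.card (W.selmerGroup 2) = 2 → W.HasSurjectiveModNGaloisRep 2 → 0 < W.Δ → padicValNat 2 W.tamagawaProduct = 0 →
      MeetsEgg W → BSDp W 2 := by
  intro W _ _ hcm hr hSel hsurj _hΔ hC0 hegg
  haveI : NeZero (W.conductorNorm ℤ) := ⟨(W.conductorNorm_pos_holds).ne'⟩
  have hT : Odd W.tamagawaProduct := by
    rcases Nat.even_or_odd W.tamagawaProduct with h | h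
    · exfalso
      have h2 : 2 ∣ W.tamagawaProduct := even_iff_two_dvd.mp h
      have h1 : 1 ≤ padicValNat 2 W.tamagawaProduct :=
        one_le_padicValNat_of_dvd W.tamagawaProduct_pos_holds.ne' h2
      omega
    · exact h
  obtain ⟨K, iF, iN, hK, hodd, h3, hH, Dt, β, ι, d₁, hc0, hy, ⟨M₀, hcM, hdiv, hndiv⟩, Wd, iE, iM, hWd, h0⟩ :=
    hS2egg0 W hcm hr hSel hT hsurj _hΔ hegg
  have hbudget : (W.Δ < 0 ∧ padicValNat 2 Wd.tamagawaProduct ≤ 1) ∨ padicValNat 2 Wd.tamagawaProduct = 0 := Or.inr h0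
  have hrk : W.mordellWeilRank = 1 := by rw [(hGZK W (le_of_eq hr)).1, hr]
  haveI hEK : (W.baseChange K).IsElliptic := isElliptic_baseChange' W K
  have hD0 : (NumberField.discr K : ℚ) ≠ 0 := by exact_mod_cast NumberField.discr_ne_zero K
  haveI hEt : (W.quadraticTwist (NumberField.discr K : ℚ)).IsElliptic := W.isElliptic_quadraticTwist hD0
  obtain ⟨Cd, hCd⟩ := hWd
  -- the Selmer clause is AUTOMATIC on the egg (this seat's `…EggSplit`): the twin is silent (`ord₂ C(Wd) = 0 = ord₂ C(W)`)
  have hSel1 : Nat.card (Wd.selmerGroup 2) = 1 :=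
    Egg.natCard_selmerGroup_twin_eq_one_of_meetsEgg_of_silent W hK hodd hH _hΔ hsurj hrk hSel Cd hCd (by rw [h0, hC0]) hegg
  -- the twin is non-CM (same `j`) of analytic rank `0`: `BSD₂(Wd)` from S1
  have hcmd : ¬ Wd.HasCM := by
    rw [← hCd, hasCM_iff_of_j_eq (((W.quadraticTwist (NumberField.discr K : ℚ)).variableChange_j Cd).trans (W.j_quadraticTwist hD0))]
    exact hcm
  obtain ⟨P₀, Hd, hP₀, hP₀K⟩ := exists_heegnerPoint_map_eq_derivedPoint_one hK hH d₁
  have hPinf : ¬ IsOfFinAddOrder P₀ := by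
    intro hfin
    apply hy
    rw [← hP₀K]
    exact (WeierstrassCurve.Affine.Point.map (W' := W)
      (algebraMap K (ringClassField K ι 1)).toRatAlgHom).isOfFinAddOrder hfin
  have hrt : (W.quadraticTwist (NumberField.discr K : ℚ)).analyticRank = 0 :=
    analyticRank_twist_eq_zero_of_rankOne W K (hGZ _ W K) hmod hK hH hr ⟨Dt, Hd, ι, hP₀⟩ hPinf
  have hrd : Wd.analyticRank = 0 := by rw [← hCd, analyticRank_smul, hrt]
  have hΔd : 0 < Wd.Δ := (Δ_twin_pos_iff W hD0 Cd hCd).mpr _hΔ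
  have hC0d : padicValNat 2 Wd.tamagawaProduct = 0 := by
    rcases hbudget with ⟨hneg, -⟩ | h0
    · exact absurd _hΔ (not_lt.mpr hneg.le)
    · exact h0
  have hBd : BSDp Wd 2 := hS1pos Wd hcmd hrd hSel1 hΔd hC0d
  exact swappedPairDescentAtTwo_maninExponent_of_facts hGZ hGZK hmod hMilneC W hr hSel hT K hK hodd h3 hH Dt hc0 β ι d₁ hy M₀ hcM
    hdiv hndiv Wd ⟨Cd, hCd⟩ hSel1 hbudget hBd

end Summit.BirchSwinnertonDyer.BirchSwinnertonDyer.Theorems.GenusExact.TwinSwap.Ledger.Line25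

end
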